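import Mathlib.Analysis.Analytic.Basic
import Mathlib.Analysis.Analytic.ChangeOrigin
import Mathlib.Analysis.Analytic.Constructions
import Mathlib.Analysis.Normed.Group.Constructions
import Mathlib.RingTheory.MvPowerSeries.Basic
import Mathlib.Topology.Algebra.InfiniteSum.Real
import Mathlib.Topology.Algebra.InfiniteSum.Constructions

/-!
# `SectorToKernel`, line `effective-cube-surjection`: series bookkeeping for stub S2

Helper file for the stub `stub_admissibleOfTame` of the crux `FurushoPentagon.SectorToKernel`
(stmt-KontsevichZagierPeriods-10813): pure analysis, no period calculus.

* `admOfTame_exists_uniform_radius` — a function analytic at every point of a compact set `K` has,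
  for one `δ > 0`, a power series expansion on the ball of radius `δ` around EVERY point of `K`
  (finite subcover + `HasFPowerSeriesOnBall.changeOrigin`).
* `admOfTame_hasFPowerSeriesOnBall_rescale` — `x ↦ f (x₀ + N⁻¹ • x)` has a power series at `0` of
  radius `N δ` when `f` has one at `x₀` of radius `δ`.
* `admOfTame_hasFPowerSeriesOnBall_sum` — finite sums.
* `admOfTame_exists_mvPowerSeries` — **the bridge**: a function on `ℝⁿ` (sup norm) with a power series
  at `0` of radius `> n ρ`, `ρ ≥ 1`, is on the closed unit cube the sum of ONE multivariable power
  series `F` with `∑ₐ |Fₐ| ρ^{|a|} < ∞` (expand `pₘ(x, …, x)`, `x = ∑ xᵢ eᵢ`, by multilinearity and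
  regroup the absolutely convergent double series by monomials).

References: S. G. Krantz, H. R. Parks, *A Primer of Real Analytic Functions* (2002), §2.2;
folklore.
-/

noncomputable section

namespace Summit.KontsevichZagierPeriods.FurushoPentagon.SectorToKernel

open Set Filter
open scoped NNReal ENNReal Topology

/-! ## A uniform radius of convergence on a compact set -/

/-- **Uniform radius.** If `f` is analytic at every point of a compact set `K` (values in a complete
space), there is one `δ > 0` such that `f` has a power series expansion on the ball of radius `δ`
around every point of `K`: cover `K` by finitely many half-balls of convergence and re-expand
(`HasFPowerSeriesOnBall.changeOrigin`). [Krantz–Parks 2002, §2.2; folklore] -/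
theorem admOfTame_exists_uniform_radius {𝕜 E F : Type*} [NontriviallyNormedField 𝕜]
    [NormedAddCommGroup E] [NormedSpace 𝕜 E] [NormedAddCommGroup F] [NormedSpace 𝕜 F]
    [CompleteSpace F] {f : E → F} {K : Set E} (hK : IsCompact K) (hf : AnalyticOnNhd 𝕜 f K) :
    ∃ δ : ℝ≥0, 0 < δ ∧ ∀ x ∈ K, ∃ q : FormalMultilinearSeries 𝕜 E F,
      HasFPowerSeriesOnBall f q x δ := by
  classical
  have h1 : ∀ x ∈ K, ∃ q : FormalMultilinearSeries 𝕜 E F, ∃ r : ℝ≥0, 0 < r ∧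
      HasFPowerSeriesOnBall f q x r := by
    intro x hx
    obtain ⟨q, r, hr⟩ := hf x hx
    obtain ⟨r', hr'0, hr'r⟩ := ENNReal.lt_iff_exists_nnreal_btwn.1 hr.r_pos
    exact ⟨q, r', by exact_mod_cast hr'0, hr.mono hr'0 hr'r.le⟩
  choose! q r hr0 hqr using h1
  obtain ⟨t, htK, hcov⟩ := hK.elim_nhds_subcover (fun x => Metric.eball x ((r x / 2 : ℝ≥0) : ℝ≥0∞))
    fun x hx => Metric.eball_mem_nhds x (by exact_mod_cast half_pos (hr0 x hx))
  rcases t.eq_empty_or_nonempty with ht | ht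
  · refine ⟨1, one_pos, fun x hx => ?_⟩
    have := hcov hx
    simp [ht] at this
  refine ⟨t.inf' ht fun x => r x / 2, (Finset.lt_inf'_iff ht).2 fun x hx => half_pos (hr0 x (htK x hx)),
    fun y hy => ?_⟩
  obtain ⟨x, hxt, hyx⟩ : ∃ x ∈ t, y ∈ Metric.eball x ((r x / 2 : ℝ≥0) : ℝ≥0∞) := by
    simpa only [mem_iUnion, exists_prop] using hcov hy
  have hxK : x ∈ K := htK x hxt
  have hz : (‖y - x‖₊ : ℝ≥0∞) < (r x / 2 : ℝ≥0) := by
    rwa [Metric.mem_eball, edist_eq_enorm_sub, enorm_lt_coe, ← ENNReal.coe_lt_coe] at hyx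
  have hz' : (‖y - x‖₊ : ℝ≥0∞) < r x :=
    hz.trans_le (by exact_mod_cast half_le_self (hr0 x hxK).le)
  have h2 := (hqr x hxK).changeOrigin hz'
  rw [add_sub_cancel] at h2
  refine ⟨_, h2.mono (by exact_mod_cast (Finset.lt_inf'_iff ht).2 fun x hx => half_pos (hr0 x (htK x hx))) ?_⟩
  rw [← ENNReal.coe_sub, ENNReal.coe_le_coe]
  refine (Finset.inf'_le _ hxt).trans ?_
  refine le_tsub_of_add_le_right ?_
  have hle : ‖y - x‖₊ ≤ r x / 2 := by exact_mod_cast hz.le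
  calc r x / 2 + ‖y - x‖₊ ≤ r x / 2 + r x / 2 := add_le_add le_rfl hle
    _ = r x := add_halves (r x)

/-! ## Rescaling and finite sums of power series expansions -/

/-- **Rescaling.** If `f` has a power series expansion at `x₀` on the ball of radius `δ`, then for a
positive integer `N` the function `x ↦ f (x₀ + N⁻¹ • x)` has one at `0` on the ball of radius `N δ`
(composition with the continuous linear map `N⁻¹ • id`, of norm `≤ N⁻¹`). [folklore] -/
theorem admOfTame_hasFPowerSeriesOnBall_rescale {E F : Type*} [NormedAddCommGroup E]
    [NormedSpace ℝ E] [NormedAddCommGroup F] [NormedSpace ℝ F] {f : E → F}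
    {q : FormalMultilinearSeries ℝ E F} {x₀ : E} {δ : ℝ≥0} (hδ : 0 < δ)
    (h : HasFPowerSeriesOnBall f q x₀ δ) {N : ℕ} (hN : 0 < N) :
    HasFPowerSeriesOnBall (fun x => f (x₀ + (N : ℝ)⁻¹ • x))
      (q.compContinuousLinearMap ((N : ℝ)⁻¹ • ContinuousLinearMap.id ℝ E)) 0
      (((N : ℝ≥0) * δ : ℝ≥0) : ℝ≥0∞) := by
  have h1 : HasFPowerSeriesOnBall (fun z => f (z - -x₀)) q
      (((N : ℝ)⁻¹ • ContinuousLinearMap.id ℝ E) 0) δ := by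
    have := h.comp_sub (-x₀)
    rwa [add_neg_cancel, ← map_zero ((N : ℝ)⁻¹ • ContinuousLinearMap.id ℝ E)] at this
  have h2 := h1.compContinuousLinearMap
  have hfun : ((fun z => f (z - -x₀)) ∘ ((N : ℝ)⁻¹ • ContinuousLinearMap.id ℝ E)) =
      fun x => f (x₀ + (N : ℝ)⁻¹ • x) := by
    funext x
    simp only [Function.comp_apply, FunLike.coe_smul, Pi.smul_apply,
      ContinuousLinearMap.coe_id', id_eq, sub_neg_eq_add, add_comm]
  rw [hfun] at h2
  have hN' : (N : ℝ≥0) ≠ 0 := by exact_mod_cast hN.ne'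
  have hnorm' : ‖(N : ℝ)⁻¹ • ContinuousLinearMap.id ℝ E‖ ≤ (N : ℝ)⁻¹ :=
    ContinuousLinearMap.opNorm_le_bound _ (by positivity) fun x => by
      rw [FunLike.coe_smul, Pi.smul_apply, ContinuousLinearMap.coe_id', id_eq,
        norm_smul, norm_inv, Real.norm_natCast]
  have hnorm : ‖(N : ℝ)⁻¹ • ContinuousLinearMap.id ℝ E‖ₑ ≤ (((N : ℝ≥0)⁻¹ : ℝ≥0) : ℝ≥0∞) := by
    rw [enorm_le_coe, ← NNReal.coe_le_coe, coe_nnnorm, NNReal.coe_inv, NNReal.coe_natCast]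
    exact hnorm'
  have hle : (((N : ℝ≥0) * δ : ℝ≥0) : ℝ≥0∞) ≤
      (δ : ℝ≥0∞) / ‖(N : ℝ)⁻¹ • ContinuousLinearMap.id ℝ E‖ₑ := by
    calc (((N : ℝ≥0) * δ : ℝ≥0) : ℝ≥0∞) = (δ : ℝ≥0∞) / (((N : ℝ≥0)⁻¹ : ℝ≥0) : ℝ≥0∞) := by
          rw [ENNReal.coe_inv hN', ENNReal.div_eq_inv_mul, inv_inv, ENNReal.coe_mul, mul_comm]
      _ ≤ _ := ENNReal.div_le_div_left hnorm _
  exact h2.mono (by exact_mod_cast mul_pos (by exact_mod_cast hN) hδ) hle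

/-- **Finite sums** of functions with power series expansions on a common ball. [folklore] -/
theorem admOfTame_hasFPowerSeriesOnBall_sum {𝕜 E F ι : Type*} [NontriviallyNormedField 𝕜]
    [NormedAddCommGroup E] [NormedSpace 𝕜 E] [NormedAddCommGroup F] [NormedSpace 𝕜 F]
    (s : Finset ι) {f : ι → E → F} {p : ι → FormalMultilinearSeries 𝕜 E F} {x : E} {r : ℝ≥0∞}
    (hr : 0 < r) (h : ∀ i ∈ s, HasFPowerSeriesOnBall (f i) (p i) x r) :
    HasFPowerSeriesOnBall (fun y => ∑ i ∈ s, f i y) (∑ i ∈ s, p i) x r := by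
  classical
  induction s using Finset.induction_on with
  | empty =>
    simp only [Finset.sum_empty]
    exact ⟨by simp, hr, fun _ => by simp⟩
  | insert a s ha ih =>
    simp only [Finset.sum_insert ha]
    exact (h a (Finset.mem_insert_self a s)).add
      (ih fun i hi => h i (Finset.mem_insert_of_mem hi))

/-! ## From a power series at `0` on `ℝⁿ` to one multivariable power series -/

/-- The multi-index `∑ⱼ e_{ι j}` of a colouring `ι : Fin m → Fin n` has total degree `m`. [folklore] -/
theorem admOfTame_mindex_degree {n m : ℕ} (ι : Fin m → Fin n) :
    ((∑ j, Finsupp.single (ι j) (1 : ℕ)).sum fun _ e => e) = m := by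
  rw [← Finsupp.sum_finsetSum_index (fun _ => rfl) (fun _ _ _ => rfl)]
  simp [Finsupp.sum_single_index]

/-- The monomial of the multi-index `∑ⱼ e_{ι j}` is `∏ⱼ x_{ι j}`. [folklore] -/
theorem admOfTame_mindex_monomial {n m : ℕ} (ι : Fin m → Fin n) (x : Fin n → ℝ) :
    ((∑ j, Finsupp.single (ι j) (1 : ℕ)).prod fun i e => x i ^ e) = ∏ j, x (ι j) := by
  rw [← Finsupp.prod_finsetSum_index (fun _ => pow_zero _) (fun _ _ _ => pow_add _ _ _)]
  simp [Finsupp.prod_single_index]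

/-- **Multilinear expansion**: `pₘ(y, …, y) = ∑_{ι : Fin m → Fin n} (∏ⱼ y_{ι j}) · pₘ(e_{ι 0}, …, e_{ι (m-1)})`
for `y = ∑ᵢ yᵢ eᵢ ∈ ℝⁿ`. [folklore] -/
theorem admOfTame_apply_diag_eq_sum {n m : ℕ}
    (P : ContinuousMultilinearMap ℝ (fun _ : Fin m => Fin n → ℝ) ℝ) (y : Fin n → ℝ) :
    P (fun _ => y) =
      ∑ ι : Fin m → Fin n, (∏ j, y (ι j)) * P (fun j => Pi.single (ι j) (1 : ℝ)) := by
  classical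
  have hy : (fun _ : Fin m => y) = fun _ => ∑ i, Pi.single i (y i) := by
    funext j
    exact (Finset.univ_sum_single y).symm
  rw [hy, ContinuousMultilinearMap.map_sum P (fun _ i => (Pi.single i (y i) : Fin n → ℝ))]
  refine Finset.sum_congr rfl fun ι _ => ?_
  have : (fun j => (Pi.single (ι j) (y (ι j)) : Fin n → ℝ)) =
      fun j => y (ι j) • (Pi.single (ι j) (1 : ℝ) : Fin n → ℝ) := by
    funext j
    rw [← Pi.single_smul', smul_eq_mul, mul_one]
  rw [this, ContinuousMultilinearMap.map_smul_univ, smul_eq_mul]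

/-- The coefficients `pₘ(e_{ι 0}, …, e_{ι (m-1)})` are bounded by `‖pₘ‖` (the `eᵢ` have sup norm `1`).
[folklore] -/
theorem admOfTame_abs_apply_single_le {n m : ℕ}
    (P : ContinuousMultilinearMap ℝ (fun _ : Fin m => Fin n → ℝ) ℝ) (ι : Fin m → Fin n) :
    |P (fun j => Pi.single (ι j) (1 : ℝ))| ≤ ‖P‖ := by
  classical
  have h := P.le_opNorm fun j => (Pi.single (ι j) (1 : ℝ) : Fin n → ℝ)
  simp only [Pi.norm_single, norm_one, Finset.prod_const_one, mul_one] at h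
  rwa [Real.norm_eq_abs] at h

/-- The fibres of the multi-index map on colourings `Σ m, (Fin m → Fin n)` are finite (a colouring
with multi-index `a` has length `|a|`). [folklore] -/
theorem admOfTame_fibre_finite {n : ℕ} (a : Fin n →₀ ℕ) :
    ((fun t : Σ m : ℕ, (Fin m → Fin n) => ∑ j, Finsupp.single (t.2 j) (1 : ℕ)) ⁻¹' {a}).Finite := by
  refine (Set.finite_range fun ι : Fin (a.sum fun _ e => e) → Fin n =>
    (⟨a.sum fun _ e => e, ι⟩ : Σ m : ℕ, (Fin m → Fin n))).subset ?_
  rintro ⟨m, ι⟩ ht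
  rw [Set.mem_preimage, Set.mem_singleton_iff] at ht
  have hm : m = a.sum fun _ e => e := by rw [← ht, admOfTame_mindex_degree]
  subst hm
  exact ⟨ι, rfl⟩

/-- Points of the closed unit cube of `ℝⁿ` have sup norm `≤ n` (`≤ 1` if `n ≥ 1`, and `0` if `n = 0`).
[folklore] -/
theorem admOfTame_norm_le_of_mem_cube {n : ℕ} {x : Fin n → ℝ} (hx : ∀ i, 0 ≤ x i ∧ x i ≤ 1) :
    ‖x‖ ≤ (n : ℝ) := by
  refine (pi_norm_le_iff_of_nonneg (Nat.cast_nonneg n)).2 fun i => ?_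
  rw [Real.norm_eq_abs, abs_of_nonneg (hx i).1]
  exact (hx i).2.trans (by exact_mod_cast Nat.one_le_iff_ne_zero.mpr (Fin.pos i).ne')

/-- **The bridge from a power series at `0` on `ℝⁿ` to a multivariable power series.** If
`g : ℝⁿ → ℝ` (sup norm) has a power series expansion `p` at `0` on the ball of radius `R > n ρ`,
`ρ ≥ 1`, then there is a multivariable power series `F = ∑ₐ Fₐ xᵃ` with `∑ₐ |Fₐ| ρ^{|a|} < ∞` which
sums to `g` at every point of the closed unit cube: expand `pₘ(x, …, x)` by multilinearity along
`x = ∑ᵢ xᵢ eᵢ` into `nᵐ` terms bounded by `‖pₘ‖`, so that the double series converges absolutely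
(`∑ₘ ‖pₘ‖ (n ρ)ᵐ < ∞`), and regroup it along the multi-index of each term.
[Krantz–Parks 2002, §2.2; folklore] -/
theorem admOfTame_exists_mvPowerSeries {n : ℕ} {g : (Fin n → ℝ) → ℝ}
    {p : FormalMultilinearSeries ℝ (Fin n → ℝ) ℝ} {R : ℝ≥0∞} (hg : HasFPowerSeriesOnBall g p 0 R)
    {ρ : ℝ≥0} (hρ : 1 ≤ ρ) (hR : (((n : ℝ≥0) * ρ : ℝ≥0) : ℝ≥0∞) < R) :
    ∃ F : MvPowerSeries (Fin n) ℝ,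
      Summable (fun a : Fin n →₀ ℕ => |MvPowerSeries.coeff a F| * (ρ : ℝ) ^ (a.sum fun _ e => e)) ∧
      ∀ x : Fin n → ℝ, (∀ i, 0 ≤ x i ∧ x i ≤ 1) →
        HasSum (fun a : Fin n →₀ ℕ => MvPowerSeries.coeff a F * a.prod (fun j e => x j ^ e))
          (g x) := by
  classical
  -- the coefficients of the colourings, their multi-indices, and the regrouped coefficients
  set A : (Σ m : ℕ, (Fin m → Fin n)) → ℝ := fun t => p t.1 (fun j => Pi.single (t.2 j) (1 : ℝ))
    with hA_def
  set μ : (Σ m : ℕ, (Fin m → Fin n)) → (Fin n →₀ ℕ) := fun t => ∑ j, Finsupp.single (t.2 j) 1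
    with hμ_def
  set c : (Fin n →₀ ℕ) → ℝ := fun a => ∑' t : μ ⁻¹' {a}, A t with hc_def
  have hfin : ∀ a, (μ ⁻¹' {a}).Finite := fun a => admOfTame_fibre_finite a
  have hdeg : ∀ a (t : μ ⁻¹' {a}), (a.sum fun _ e => e) = t.1.1 := by
    rintro a ⟨⟨m, ι⟩, ht⟩
    rw [Set.mem_preimage, Set.mem_singleton_iff] at ht
    subst ht
    exact admOfTame_mindex_degree ι
  have hmon : ∀ a (t : μ ⁻¹' {a}) (x : Fin n → ℝ),
      (a.prod fun j e => x j ^ e) = ∏ j, x (t.1.2 j) := by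
    rintro a ⟨⟨m, ι⟩, ht⟩ x
    rw [Set.mem_preimage, Set.mem_singleton_iff] at ht
    subst ht
    exact admOfTame_mindex_monomial ι x
  -- absolute convergence of the double series at the polyradius `ρ`
  have hA : ∀ t, |A t| ≤ ‖p t.1‖ := fun t => admOfTame_abs_apply_single_le (p t.1) t.2
  have hρ1 : (1 : ℝ) ≤ ρ := by exact_mod_cast hρ
  have hsumT : Summable (fun t : Σ m : ℕ, (Fin m → Fin n) => |A t| * (ρ : ℝ) ^ t.1) := by
    refine (summable_sigma_of_nonneg fun t => by positivity).2 ⟨fun m => ?_, ?_⟩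
    · exact (hasSum_fintype _).summable
    · have hp : Summable fun m : ℕ => ‖p m‖ * (((n : ℝ≥0) * ρ : ℝ≥0) : ℝ) ^ m :=
        p.summable_norm_mul_pow (hR.trans_le hg.r_le)
      refine Summable.of_nonneg_of_le (fun m => tsum_nonneg fun _ => by positivity) (fun m => ?_) hp
      rw [tsum_fintype]
      calc ∑ ι : Fin m → Fin n, |A ⟨m, ι⟩| * (ρ : ℝ) ^ m
          ≤ ∑ _ι : Fin m → Fin n, ‖p m‖ * (ρ : ℝ) ^ m :=
            Finset.sum_le_sum fun ι _ => mul_le_mul_of_nonneg_right (hA ⟨m, ι⟩) (by positivity)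
        _ = (n : ℝ) ^ m * (‖p m‖ * (ρ : ℝ) ^ m) := by
            rw [Finset.sum_const, Finset.card_univ, Fintype.card_fun, Fintype.card_fin,
              Fintype.card_fin, nsmul_eq_mul, Nat.cast_pow]
        _ = ‖p m‖ * (((n : ℝ≥0) * ρ : ℝ≥0) : ℝ) ^ m := by
            rw [NNReal.coe_mul, NNReal.coe_natCast, mul_pow]; ring
  refine ⟨fun a => c a, ?_, ?_⟩
  · -- summable majorant of the regrouped coefficients
    have hfib := hsumT.hasSum.tsum_fiberwise μ
    refine Summable.of_nonneg_of_le (fun a => by positivity) (fun a => ?_) hfib.summable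
    haveI := (hfin a).to_subtype
    show |c a| * (ρ : ℝ) ^ (a.sum fun _ e => e) ≤ ∑' t : μ ⁻¹' {a}, |A t| * (ρ : ℝ) ^ t.1.1
    calc |c a| * (ρ : ℝ) ^ (a.sum fun _ e => e)
        ≤ (∑' t : μ ⁻¹' {a}, |A t|) * (ρ : ℝ) ^ (a.sum fun _ e => e) := by
          refine mul_le_mul_of_nonneg_right ?_ (by positivity)
          have h := norm_tsum_le_tsum_norm (f := fun t : μ ⁻¹' {a} => A t)
            (Summable.of_finite)
          simpa only [Real.norm_eq_abs] using h
      _ = ∑' t : μ ⁻¹' {a}, |A t| * (ρ : ℝ) ^ (a.sum fun _ e => e) := tsum_mul_right.symm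
      _ = ∑' t : μ ⁻¹' {a}, |A t| * (ρ : ℝ) ^ t.1.1 := tsum_congr fun t => by rw [hdeg a t]
  · -- summation at a point of the cube
    intro x hx
    have hxR : x ∈ Metric.eball (0 : Fin n → ℝ) R := by
      rw [Metric.mem_eball, edist_zero_right]
      refine lt_of_le_of_lt ?_ hR
      rw [enorm_le_coe, ← NNReal.coe_le_coe, coe_nnnorm, NNReal.coe_mul, NNReal.coe_natCast]
      calc ‖x‖ ≤ (n : ℝ) := admOfTame_norm_le_of_mem_cube hx
        _ = (n : ℝ) * 1 := (mul_one _).symm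
        _ ≤ (n : ℝ) * ρ := mul_le_mul_of_nonneg_left hρ1 (Nat.cast_nonneg n)
    have h1 : HasSum (fun m => p m fun _ => x) (g x) := by
      simpa only [zero_add] using hg.hasSum hxR
    set u : (Σ m : ℕ, (Fin m → Fin n)) → ℝ := fun t => (∏ j, x (t.2 j)) * A t with hu_def
    have hprod : ∀ (m : ℕ) (ι : Fin m → Fin n), |∏ j, x (ι j)| ≤ 1 := by
      intro m ι
      rw [Finset.abs_prod]
      exact Finset.prod_le_one (fun j _ => abs_nonneg _) fun j _ => by
        rw [abs_of_nonneg (hx (ι j)).1]; exact (hx (ι j)).2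
    have hu : Summable u := by
      refine hsumT.of_norm_bounded fun t => ?_
      rw [Real.norm_eq_abs, hu_def, abs_mul]
      calc |∏ j, x (t.2 j)| * |A t| ≤ 1 * |A t| :=
            mul_le_mul_of_nonneg_right (hprod t.1 t.2) (abs_nonneg _)
        _ = |A t| * 1 := by ring
        _ ≤ |A t| * (ρ : ℝ) ^ t.1 :=
            mul_le_mul_of_nonneg_left (one_le_pow₀ hρ1) (abs_nonneg _)
    have h2 : HasSum u (g x) := by
      refine HasSum.sigma_of_hasSum (f := u) h1 (fun m => ?_) hu
      rw [admOfTame_apply_diag_eq_sum (p m) x]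
      exact hasSum_fintype fun ι : Fin m → Fin n => u ⟨m, ι⟩
    have h3 := h2.tsum_fiberwise μ
    have key : (fun a : Fin n →₀ ℕ => MvPowerSeries.coeff a (show MvPowerSeries (Fin n) ℝ from
        fun a => c a) * a.prod fun j e => x j ^ e) = fun a => ∑' t : μ ⁻¹' {a}, u t := by
      funext a
      haveI := (hfin a).to_subtype
      show c a * (a.prod fun j e => x j ^ e) = ∑' t : μ ⁻¹' {a}, u t
      calc c a * (a.prod fun j e => x j ^ e)
          = ∑' t : μ ⁻¹' {a}, A t * (a.prod fun j e => x j ^ e) := tsum_mul_right.symm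
        _ = ∑' t : μ ⁻¹' {a}, u t := tsum_congr fun t => by rw [hmon a t x, hu_def, mul_comm]
    rw [key]
    exact h3

/-- **Registered form of the series bridge** (`admOfTame_exists_mvPowerSeries`, all arguments explicit):
from a power series at `0` of sup-radius `> n ρ`, `ρ ≥ 1`, to one multivariable power series with
summable majorant of polyradius `ρ` summing to the function on the closed unit cube.
[Krantz–Parks 2002, §2.2; folklore] -/
theorem admOfTame_seriesBridge :
    ∀ (n : ℕ) (g : (Fin n → ℝ) → ℝ) (p : FormalMultilinearSeries ℝ (Fin n → ℝ) ℝ) (R : ENNReal) (ρ : NNReal), HasFPowerSeriesOnBall g p 0 R → 1 ≤ ρ → (((n : NNReal) * ρ : NNReal) : ENNReal) < R → ∃ F : MvPowerSeries (Fin n) ℝ, Summable (fun a : Fin n →₀ ℕ => |MvPowerSeries.coeff a F| * (ρ : ℝ) ^ (a.sum fun _ e => e)) ∧ ∀ x : Fin n → ℝ, (∀ i, 0 ≤ x i ∧ x i ≤ 1) → HasSum (fun a : Fin n →₀ ℕ => MvPowerSeries.coeff a F * a.prod (fun j e => x j ^ e)) (g x) :=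
  fun _ _ _ _ _ hg hρ hR => admOfTame_exists_mvPowerSeries hg hρ hR

end Summit.KontsevichZagierPeriods.FurushoPentagon.SectorToKernel
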